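import Summits.Ventures.PercRepro.S2DichotomyTools
import Summits.Ventures.PercRepro.S2TopCountCell
import Summits.Ventures.PercRepro.S2PhiFifteenFive
import Summits.Ventures.PercRepro.TriangleCapEightI
import Summits.Ventures.PercRepro.S1CoreCapSevenFinal
import Summits.Ventures.PercRepro.S1FiveCircuitBase

/-!
# PercRepro — S2: THE SCALED CELL `(14, 7)` AT `K₁ = 16688` — THE COLOOP CASE OF `(15, 7)` (p7, gen 12; sub-claim S2)

The cell `(15, 7)` splits off a coloop `e`: `M ＼ {e}` is an `e`-free core of rank `14` on `21` points and the inequality to prove is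
`(Φ(15, 5) − 2)/2 · #U(14, 5) ≤ #Y(14, 5)` (the sharpened coloop step `weighted_of_isColoop_scaled_sharp`, `(389/6 − 2)/2 ≤ 2^19/16688`).
On the standard caps `11 / 64 / 401` (`cq3 7`, `avgBoundSeven 0`, `avgChain5b 7`) the nested dichotomy with the kit's tail closes it
(g11's gencell15.py at `(14, 7)`, `K = 16688`: cases `ν = 6, 5` full, `ν = 4` paid, spread `55,432` against `56,517`):
**`c025_fourteen_seven_scaled`**. Axioms: standard.
-/

open scoped Matroid

namespace PercRepro

namespace ThmN

open Set

variable {α : Type}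

/-- The standard caps at `(14, 7)`: `s₃ ≤ 11`, `s₄ ≤ 64`, `s₅ ≤ 401` on every `e`-free core of nullity `7`. -/
theorem caps_fourteen_seven_scaled (M : Matroid α) [M.Finite]
    (hd : M.E.encard = M.eRank + ((7 : ℕ) : ℕ∞))
    (hfree : ∀ e ∈ M.E, ∃ A ⊆ M.E \ {e}, e ∉ M.closure A ∧ e ∉ M.closure ((M.E \ {e}) \ A)) :
    {C : Set α | M.IsCircuit C ∧ C.ncard = 3}.ncard ≤ 11 ∧
      {C : Set α | M.IsCircuit C ∧ C.ncard = 4}.ncard ≤ 64 ∧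
        {C : Set α | M.IsCircuit C ∧ C.ncard = 5}.ncard ≤ 401 := by
  have hs3 := TriangleCap.core_ncard_triangles_le_cq3 M hfree hd
  rw [show TriangleCap.cq3 7 = 11 by decide] at hs3
  have hs4 := S1.ncard_fourCircuits_le_avgBoundSeven 0 M hfree (by convert hd using 2; norm_num)
  rw [show S1.avgBoundSeven 0 = 64 by decide] at hs4
  have hs5 := S1.ncard_fiveCircuits_le_avgChain5b 7 M hfree hd
  rw [show S1.avgChain5b 7 = 401 by decide] at hs5
  exact ⟨hs3, hs4, hs5⟩

/-- **The top count at `(14, 7)` by the nested dichotomy**: `#U(14, 5) ≤ 56517` on every `e`-free core of rank `14` on `21`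
points (the cases `ν = 6, …, 4` on `≤ 11, …, 9` points, then spread). -/
theorem topCount_le_fourteen_seven_scaled (M : Matroid α) [M.Finite]
    (hR : M.eRank = ((14 : ℕ) : ℕ∞)) (hn : M.E.ncard = 14 + 7)
    (hfree : ∀ e ∈ M.E, ∃ A ⊆ M.E \ {e}, e ∉ M.closure A ∧ e ∉ M.closure ((M.E \ {e}) \ A)) :
    Matroid.topCount M 14 5 ≤ 56517 := by
  classical
  have hd : M.E.encard = M.eRank + ((7 : ℕ) : ℕ∞) := by
    rw [hR, ← M.ground_finite.cast_ncard_eq, hn]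
    push_cast
    ring
  obtain ⟨hs3, hs4, hs5⟩ := caps_fourteen_seven_scaled M hd hfree
  have full : ∀ (k : ℕ) {W : Set α}, W ⊆ M.E → W.encard = M.eRk W + k →
      Matroid.topCount M 14 5 ≤ ∑ m ∈ Finset.Icc 5 7, ∑ j ∈ Finset.Icc (m + k - 7) m,
        W.ncard.choose j * (14 + 7 - W.ncard).choose (m - j) := by
    intro k W hW hWk
    refine (S2.topCount_le_sum_spanning M hR hd 5).trans ?_
    refine Finset.sum_le_sum (fun m _ => ?_)
    have h := S2.ncard_spanning_compl_le_of_nullity M hW hd hWk (m := m)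
    rw [hn] at h
    exact h
  by_cases h6 : ∃ W ⊆ M.E, W.ncard ≤ 11 ∧ W.encard = M.eRk W + 6
  · obtain ⟨W, hW, hWn, hWk⟩ := h6
    refine (full 6 hW hWk).trans ?_
    generalize W.ncard = w at hWn ⊢
    interval_cases w <;> decide
  by_cases h5 : ∃ W ⊆ M.E, W.ncard ≤ 10 ∧ W.encard = M.eRk W + 5
  · obtain ⟨W, hW, hWn, hWk⟩ := h5
    refine (full 5 hW hWk).trans ?_
    generalize W.ncard = w at hWn ⊢
    interval_cases w <;> decide
  by_cases h4 : ∃ W ⊆ M.E, W.ncard ≤ 9 ∧ W.encard = M.eRk W + 4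
  · obtain ⟨W, hW, hWn, hWk⟩ := h4
    have hflat : ∀ X ⊆ M.E, M.eRk X ≤ 5 → X.ncard ≤ 9 := fun X hX hr => by
      have := S2.ncard_le_of_eRk_le_of_not_nullity M 5 10 (by norm_num) h5 hX (r := 5) (by norm_num) (by exact_mod_cast hr)
      omega
    have hflat' : ∀ X ⊆ M.E, M.eRk X ≤ 4 → X.ncard ≤ 8 := fun X hX hr => by
      have := S2.ncard_le_of_eRk_le_of_not_nullity M 5 10 (by norm_num) h5 hX (r := 4) (by norm_num) (by exact_mod_cast hr)
      omega
    have hV := S2.ncard_spanning_compl_le_of_nullity M hW hd hWk (m := 5)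
    have hV' : ∑ j ∈ Finset.Icc (5 + 4 - 7) 5, W.ncard.choose j * (M.E.ncard - W.ncard).choose (5 - j) ≤ 15102 := by
      rw [hn]
      generalize W.ncard = w at hWn ⊢
      interval_cases w <;> decide
    have hU := topCount_le_payment_flat M 14 7 (by norm_num) hR hn hfree 9 8 hflat hflat' (by norm_num) (by norm_num)
      11 64 401 hs3 hs4 hs5 15102 (hV.trans hV')
    norm_num [Finset.sum_range_succ, Nat.choose] at hU
    exact hU.trans (by norm_num)
  · -- spread: rank-`5` sets `≤ 8`, rank-`4` sets `≤ 7`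
    have hflat : ∀ X ⊆ M.E, M.eRk X ≤ 5 → X.ncard ≤ 8 := fun X hX hr => by
      have := S2.ncard_le_of_eRk_le_of_not_nullity M 4 9 (by norm_num) h4 hX (r := 5) (by norm_num) (by exact_mod_cast hr)
      omega
    have hflat' : ∀ X ⊆ M.E, M.eRk X ≤ 4 → X.ncard ≤ 7 := fun X hX hr => by
      have := S2.ncard_le_of_eRk_le_of_not_nullity M 4 9 (by norm_num) h4 hX (r := 4) (by norm_num) (by exact_mod_cast hr)
      omega
    have hU := topCount_le_flat M 14 7 (by norm_num) hR hn hfree 8 7 hflat hflat' (by norm_num) (by norm_num)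
      11 64 401 hs3 hs4 hs5
    norm_num [Finset.sum_range_succ, Nat.choose] at hU
    exact hU.trans (by norm_num)

/-- The tail side of the cell `(14, 7)` on the caps `11 / 64 / 401`: `T = 319,829 ≤ 157·2^21/1024`. -/
theorem tail_fourteen_seven_scaled :
    1024 * ((((14 + 7).choose 4 : ℚ) +
      (∑ j ∈ Finset.range 6, (Nat.choose (min 5 ((7 + 3) / 2 + 1 - 2)) j : ℚ) / (((j + 1) + 3 * (j + 1).choose 2 + 3 * (j + 1).choose 3 + 2 * (j + 1).choose 4 : ℕ) : ℚ)) *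
        ((11 * (14 + 7 - 3).choose 2 + 64 * (14 + 7 - 4) + 401 : ℕ) : ℚ) +
      ((∑ j ∈ Finset.range 6, (Nat.choose 5 j : ℚ) / (((j + 1) + 3 * (j + 1).choose 2 + 3 * (j + 1).choose 3 + 2 * (j + 1).choose 4 : ℕ) : ℚ)) -
        (∑ j ∈ Finset.range 6, (Nat.choose (min 5 ((7 + 3) / 2 + 1 - 2)) j : ℚ) / (((j + 1) + 3 * (j + 1).choose 2 + 3 * (j + 1).choose 3 + 2 * (j + 1).choose 4 : ℕ) : ℚ))) *
        ((10 : ℕ).choose 5 : ℚ)) +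
      (((14 + 7).choose 3 * 2 ^ 3 + (14 + 7).choose 2 * 2 + (14 + 7) + 1 : ℕ) : ℚ) +
      (((14 + 7).choose 5 : ℚ) + (∑ j ∈ Finset.range (7), (Nat.choose (min 13 ((7 + 6) / 2 + 1 - 2)) j : ℚ) / (((j + 1) + 3 * (j + 1).choose 2 + 3 * (j + 1).choose 3 + 2 * (j + 1).choose 4 : ℕ) : ℚ)) * ((11 * (14 + 7 - 3).choose 3 + 64 * (14 + 7 - 4).choose 2 + 401 * (14 + 7 - 5) + (7 + 5).choose 6 : ℕ) : ℚ) +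
        ((∑ j ∈ Finset.range (7), (Nat.choose (min 19 (5 + 7) - 6) j : ℚ) / (((j + 1) + 3 * (j + 1).choose 2 + 3 * (j + 1).choose 3 + 2 * (j + 1).choose 4 : ℕ) : ℚ)) - (∑ j ∈ Finset.range (7), (Nat.choose (min 13 ((7 + 6) / 2 + 1 - 2)) j : ℚ) / (((j + 1) + 3 * (j + 1).choose 2 + 3 * (j + 1).choose 3 + 2 * (j + 1).choose 4 : ℕ) : ℚ))) *
        ((min 19 (5 + 7)).choose 6 : ℚ)) +
      ((∑ j ∈ Finset.range (7 + 1), (14 + 7).choose j : ℕ) : ℚ)) ≤ (157 : ℚ) * 2 ^ (14 + 7) := by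
  have hsm : (∑ j ∈ Finset.range (7), (Nat.choose (min 13 ((7 + 6) / 2 + 1 - 2)) j : ℚ) / (((j + 1) + 3 * (j + 1).choose 2 + 3 * (j + 1).choose 3 + 2 * (j + 1).choose 4 : ℕ) : ℚ)) = 12767 / 4230 := by
    norm_num [Finset.sum_range_succ, Nat.choose]
  have hsg : (∑ j ∈ Finset.range (7), (Nat.choose (min 19 (5 + 7) - 6) j : ℚ) / (((j + 1) + 3 * (j + 1).choose 2 + 3 * (j + 1).choose 3 + 2 * (j + 1).choose 4 : ℕ) : ℚ)) = 414767 / 103635 := by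
    norm_num [Finset.sum_range_succ, Nat.choose]
  have hs4m : (∑ j ∈ Finset.range 6, (Nat.choose (min 5 ((7 + 3) / 2 + 1 - 2)) j : ℚ) / (((j + 1) + 3 * (j + 1).choose 2 + 3 * (j + 1).choose 3 + 2 * (j + 1).choose 4 : ℕ) : ℚ)) = 523 / 225 := by
    norm_num [Finset.sum_range_succ, Nat.choose]
  have hs4g : (∑ j ∈ Finset.range 6, (Nat.choose 5 j : ℚ) / (((j + 1) + 3 * (j + 1).choose 2 + 3 * (j + 1).choose 3 + 2 * (j + 1).choose 4 : ℕ) : ℚ)) = 12767 / 4230 := by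
    norm_num [Finset.sum_range_succ, Nat.choose]
  rw [hsm, hsg, hs4m, hs4g]
  simp only [Finset.sum_range_succ, Finset.sum_range_zero]
  norm_num [Nat.choose]

/-- **The cell `(14, 7)`**: `((phiK 15 5 - 2) / 2) · #U ≤ #Y` on every `e`-free core of rank `14` on `21` points (caps `11 / 64 / 401`, slack `157/1024`, `((phiK 15 5 - 2) / 2) ≤ 2^19/16688`). -/
theorem c025_fourteen_seven_scaled (M : Matroid α) [M.Finite]
    (hR : M.eRank = ((14 : ℕ) : ℕ∞)) (hn : M.E.ncard = 14 + 7)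
    (hfree : ∀ e ∈ M.E, ∃ A ⊆ M.E \ {e}, e ∉ M.closure A ∧ e ∉ M.closure ((M.E \ {e}) \ A)) :
    ((phiK 15 5 - 2) / 2) * (Matroid.topCount M 14 5 : ℚ) ≤ (Matroid.midCount M 14 5 : ℚ) := by
  classical
  have hd : M.E.encard = M.eRank + ((7 : ℕ) : ℕ∞) := by
    rw [hR, ← M.ground_finite.cast_ncard_eq, hn]
    push_cast
    ring
  obtain ⟨hs3, hs4, hs5⟩ := caps_fourteen_seven_scaled M hd hfree
  have hU := topCount_le_fourteen_seven_scaled M hR hn hfree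
  exact c025_core_five_cell_of_topCount_xqictq5g M 14 7 (by norm_num) hR hn hfree 11 64 401 hs3 hs4 hs5 56517 hU
    16688 (by norm_num) (((phiK 15 5 - 2) / 2)) (by rw [S2.phiK_fifteen_five]; norm_num) ⟨157, by norm_num, by norm_num [Nat.choose], tail_fourteen_seven_scaled⟩
end ThmN

end PercRepro
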